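import Summits.AtomisticToContinuum.BoseEinsteinCondensation.Theses.BECInsertionCorrector
import Summits.AtomisticToContinuum.BoseEinsteinCondensation.Theorems.CorrectorClosure.Negative.InsertionResidueHardCoreJamming
import Literature.MathematicalPhysics.QuantumManyBody.PeriodicHeatFlowSpectral
import Literature.MathematicalPhysics.QuantumManyBody.PeriodicBoseGasImpurity
import Literature.MathematicalPhysics.QuantumManyBody.PeriodicBoseGasTagged
import Summits.AtomisticToContinuum.BoseEinsteinCondensation.Theorems.BECInsertionCorrectorCorrectorClosureFlatDomination
import Summits.AtomisticToContinuum.BoseEinsteinCondensation.Theorems.BECInsertionCorrectorCorrectorClosureNearMinimiserRigidity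
import Summits.AtomisticToContinuum.BoseEinsteinCondensation.Theorems.BECInsertionCorrectorCorrectorClosureFlatJensen
import Summits.AtomisticToContinuum.BoseEinsteinCondensation.Theorems.BECInsertionCorrectorCorrectorClosureFidelityLimit
import Summits.AtomisticToContinuum.BoseEinsteinCondensation.Theorems.BECInsertionCorrectorCorrectorClosureGroundStateExists
import Summits.AtomisticToContinuum.BoseEinsteinCondensation.Theorems.BECInsertionCorrectorCorrectorClosureLedgerBridges
import Summits.AtomisticToContinuum.BoseEinsteinCondensation.Theorems.BECInsertionCorrectorCorrectorClosureFlatPartitionLogConvex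
import Summits.AtomisticToContinuum.BoseEinsteinCondensation.Theorems.BECInsertionCorrectorCorrectorClosureResponseDictionarySin
import Summits.AtomisticToContinuum.BoseEinsteinCondensation.Theorems.BECInsertionCorrectorCorrectorClosureTailModes
import Summits.AtomisticToContinuum.BoseEinsteinCondensation.Theorems.BECInsertionCorrectorCorrectorClosureFirstCorrector
import Summits.AtomisticToContinuum.BoseEinsteinCondensation.Theorems.BECInsertionCorrectorCorrectorClosureFirstCorrectorBound
import Summits.AtomisticToContinuum.BoseEinsteinCondensation.Theorems.BECInsertionCorrectorCorrectorClosureFloorOfRelEntropy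
import Summits.AtomisticToContinuum.BoseEinsteinCondensation.Theorems.BECInsertionCorrectorCorrectorClosureOccupationFloorFK
import Summits.AtomisticToContinuum.BoseEinsteinCondensation.Theorems.BECInsertionCorrectorCorrectorClosureRemovalLaplace
import HarnessLib.Audit

/-!
# Line `residue-area-law` — skeleton v6.2 for crux `BECInsertionCorrector.CorrectorClosure`
(item stmt-AtomisticToContinuum-12058, route route-AtomisticToContinuum-BECInsertionCorrector;
sixth line lead prover-line-stmt-AtomisticToContinuum-12058-c2-0, 2026-08-16; v5 by the fifth lead
prover-line-stmt-AtomisticToContinuum-12058-c1-0, v4 by the fourth lead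
prover-line-stmt-AtomisticToContinuum-12058-r-0, v2 by the third lead prover-line-stmt-AtomisticToContinuum-12058-1,
v1 by the crux-plan seat planner-cruxplan-stmt-AtomisticToContinuum-12058-residue-area-law-0)

Crux (fixed, by name): `CorrectorClosure := StaticResponseBound → InsertionResidue`.

Idea (card `Cruxes/CorrectorClosure/Ideas/residue-area-law.md`, triage r1-1/2/3: pass ×3): the
insertion residue is read off ONE `ℝ≥0∞`-valued function of imaginary time, the FLAT insertion
partition function `𝒵(t) = ∫_{cell^{N+1}} ψ₀ · e^{-tH_{N+1}} ψ₀`, `ψ₀(x₀, X) = Θ₀(X)` (`Θ₀` the `N`-body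
torus Feynman–Kac ground state, one particle added flat): the doubling quotient
`D(t) = 𝒵(2t)𝒵(0)/𝒵(t)²` is `≥ 1`, non-decreasing and tends to `1/A`, `A = L⁻³(∫ Θ₀ ∫_cell Φ₀)²` the
insertion residue of the TRUE ground states (`Φ₀` the `(N+1)`-body FK ground state). The composition
idea of the line: FK FRAME (ground states exist, fixed `N`) + RIGIDITY (a floor on the true ground
states transfers to all `δ`-near-minimisers, `δ` after `N`) + a FLOOR SUPPLIER (the heart).

## v6.2 (seventh lead prover-line-stmt-AtomisticToContinuum-12058-c3-0, 2026-08-16) — stubs UNCHANGED, glue LANDED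

No reshape: the three open stubs below are kept verbatim (each is crux-sized; `stub_periodicBEC` is the
body of the LIVE torus-BEC item stmt-AtomisticToContinuum-8997 `PeriodicBEC` under K1 and boundedness —
item 0826 named in v6 is closed `moot`, 8997 carries the identical signature). What changed: the
composition is now a landed, importable, sorry-free theorem
(`Theorems/BECInsertionCorrectorCorrectorClosureReductionToFactors.lean`, p122159:
`residueFloor_of_factors'`, `correctorClosure_of_factors`, and the planner-level form
`correctorClosure_of_periodicBEC` = item 8997's signature + the two route factors ⇒ `CorrectorClosure`),
so the glue below (kept verbatim, it elaborates without that import) is also available as a one-line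
application of it, and the crux is kernel-checked to sit,
modulo K1, between `PeriodicBEC` (necessity: `periodicBEC_of_correctorClosure`, p121285) and
`PeriodicBEC ∧ removal fidelity ∧ hard-core case` (sufficiency: p122159). Artefact audit of the
definitions redone by this lead (PICKED.md (2)): no vacuous `¬K1(v₀)`, no trivial target.

## v6 (this lead, 2026-08-16) — the heart FACTORISED: torus BEC × removal (hole) residue

The v5 heart `stub_residueFloor` (K1 ⇒ `N`-uniform floor `c ≤ A` on the ground-state residue, bounded
`v`) factorises EXACTLY. With `G(X) := ∫_cell Φ₀(x, X) dx` (the zero-mode REMOVAL amplitude of the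
`(N+1)`-body ground state; `G > 0`),
`A = L⁻³ (∫_{cell^N} Θ₀ G)² = f₀ · F`, `f₀ := L⁻³ ∫_{cell^N} G² = taggedZeroModeOccupation N L Φ₀`
(the one-particle zero-mode occupation of `Φ₀`, `= ⟨Φ₀, n₀ Φ₀⟩/(N+1)`, `≤ 1`) and
`F := (∫ Θ₀ G)² / ∫ G²` (the REMOVAL FIDELITY: overlap of the `N`-body ground state with the
normalised removal state `Ĝ = G/‖G‖ ∝ a₀Φ₀`, `≤ 1`). Hence (both factors `≤ 1`)
`A ≥ c ⟹ f₀ ≥ c ∧ F ≥ c` and `f₀ ≥ c₁ ∧ F ≥ c₂ ⟹ A ≥ c₁c₂`: the heart is EQUIVALENT to the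
conjunction of
* `stub_periodicBEC` — K1 ⇒ torus BEC of near-minimisers for bounded `v`, typed VERBATIM as the body
  of the summit-wide statement `PeriodicBEC` (item stmt-AtomisticToContinuum-0826, the target/crux of
  ≥ 8 routes of this sub-problem) under the extra hypotheses `StaticResponseBound` and `v` bounded;
  transferred to the FK ground state `Φ₀` by the PROVABLE fixed-`N` bridge
  `stub_occupationFloorFK_of_window` (near-minimisers are `L²`-close to the ground ray,
  `rigidity_of_nearMinimiser`, and `Ψ ↦ √f₀(Ψ)` is `1`-Lipschitz in `L²(cell^{N+1})`);
* `stub_removalFidelity` — K1 ⇒ `N`-uniform floor `c₂ ∫G² ≤ (∫Θ₀G)²` on the removal fidelity (the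
  `k = 0` HOLE quasi-particle residue `Z_hole = |⟨Θ₀, a₀Φ₀⟩|²/⟨Φ₀, a₀†a₀Φ₀⟩`; Bogoliubov:
  `1 − O(√(ρa³))`). Its first brick is registered and provable now: `stub_removalLaplace`, the
  Laplace-transform (imaginary-time) energy bound of the removal state,
  `e^{-tE₀(N+1)} (∫G²)² ≤ L³ ∫ G·e^{-tH_N}G` — i.e. `Ĝ` has FK energy `≤ μ_N + t⁻¹ log(1/f₀)` above
  NOTHING but `E₀(N+1)`, with NO Born term: unlike the flat INSERTION state (mean excitation energy
  `ρ_N∫v − μ_N`, `= ∞` for hard cores) the removal state is automatically pair-dressed, so the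
  removal form of the heart is the one that survives `⊤`-valued `v` (hole `stub_unboundedCase`).
Why this reshape: it makes kernel-checked (glue below + Disproof §5) that EVERY floor supplier of this
crux contains torus BEC of the true ground states given K1 (`A ≤ f₀`, `Negative.overlap_sq_le_
taggedZeroModeOccupation`), and it separates that summit-wide open statement (now comparable by name
with item 0826 and its routes) from the route-specific residue `F`. Neither factor is claimed
provable here: `stub_periodicBEC` is `K1 → PeriodicBEC(v)` (open; no `K1 ⇒ BEC` mechanism in print —
K1 controls the density sector, BEC lives in the one-body sector; in `d = 1` the K1-analogue EXCLUDES
BEC, Disproof §13), `stub_removalFidelity` is the hole residue at the thermodynamic scale (open in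
print beyond GP/MF scaling: Lampart–Triay 2025 Cor. 1.6, Myśliwy–Seiringer 2020).

Stubs registered in v6 (5): `stub_periodicBEC` (XL, open, lead), `stub_removalFidelity` (XL, open,
lead), `stub_unboundedCase` (crux-sized hole, unchanged, undelegated), `stub_occupationFloorFK_of_window`
(M, worker; consumed by the glue) — LANDED by wave 1 (p120721, `…Theorems/BECInsertionCorrectorCorrectorClosureOccupationFloorFK.lean`,
now imported), `stub_removalLaplace` (M/L, worker; first brick of `stub_removalFidelity`) — LANDED by
wave 1 (p120495, `…RemovalLaplace.lean`, now imported); the v5 layer-1 lemmas stay imported (landed: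
`stub_firstCorrectorBound` p117568, `stub_floorOfRelEntropy` p118398). v6.1 keeps 3 sorries: the two
open factors and the hole. `CorrectorClosure_of` is sorry-free given the stubs and concludes the crux BY NAME.

## v5 (fifth lead) — the heart in its neutral FLOOR form, plus two provable layer-1 stubs (record)

* v5 heart `stub_residueFloor`: K1 ⇒ an `N`-uniform floor `c ≤ A` on the insertion residue of the
  torus FK ground states (bounded `v`); EQUIVALENT to v4's ledger heart `stub_uniformLedger`
  (`residueFloor_of_uniformLedger` / `uniformLedger_of_residueFloor`, p94707, p94264) and implied by
  line `healing-scale-kac-insertion`'s heart (`residueFloor_of_kac`). v6 derives it from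
  `stub_periodicBEC ∧ stub_removalFidelity` (`residueFloor_of_factors` below, sorry-free given the stubs).
* `stub_firstCorrectorBound` (LANDED p117568 + aux p102475 p102472 p102473 p104832 p112146): K1 ⇒
  `N`-uniform Kipnis–Varadhan `H₋₁` bound `‖W̃‖²₋₁ ≤ C₁N` of the centred impurity coupling for the
  product weight `Θ₀ ∘ vecTail` (route FirstCorrectorBounds in `hMinusOneSqW` vocabulary).
* `stub_floorOfRelEntropy` (LANDED p118398): `exp(−KL(Q‖P)) ≤ A` (entropy lever).

## v4 (fourth lead) and earlier (record)

Five of the seven v2/v3 stubs LANDED and imported: `stub_groundStateExists` (p92339; named fact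
`PeriodicGroundStateFeynmanKac_holds`), `stub_flatDomination` (p83175), `stub_flatJensen` (p93424),
`stub_fidelityLimit` (p92249), `stub_nearMinimiserRigidity` (p85784, namespace
`…Theorems.CorrectorClosure.HealingScaleKacInsertion`). v1–v3's `stub_dyadicTail` → v4
`stub_uniformLedger` (Disproof §16) → v5 `stub_residueFloor` → v6 factors.

## Disproof.lean (gen 4 v10) and landed `Negative/*` — obligations

§1 K1 is consumed BY NAME in `stub_periodicBEC`, `stub_removalFidelity` (and `stub_unboundedCase`);
the fixed-`N` stubs are K1-free. §3 the window on `Ψ` is used in `stub_nearMinimiserRigidity` only.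
§4 `E₀^per < ⊤` enters through `IsPeriodicGroundStateFK.energy_ne_top`. §5 is now PART OF THE GLUE
(`A = f₀·F ≤ f₀`): the heart contains torus BEC by construction, not by accident. §7 `δ` is produced
AFTER `N`. §5/§8 constants `c₁c₂/2 < 1`; free gas: `f₀ = F = A = 1`. §10 every density threshold is
`∃ ρᵢ > 0`. §13 the dimension test lives in `stub_periodicBEC` (torus BEC fails in `d = 1`). §16:
no claim below `S(k)²/2` anywhere. No `-- Targets` theorem names a stub of this line (v10).
-/

noncomputable section

open MeasureTheory Filter Matrix
open scoped ENNReal NNReal BigOperators ComplexConjugate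

namespace Summit.AtomisticToContinuum.BoseEinsteinCondensation.Cruxes.CorrectorClosure.ResidueAreaLaw

open Literature.MathematicalPhysics.QuantumManyBody.BoseGas
open Summit.AtomisticToContinuum.BoseEinsteinCondensation.Theses.BECInsertionCorrector
open Summit.AtomisticToContinuum.BoseEinsteinCondensation.Theorems.CorrectorClosure.Negative
  (sideLength_succ_pos sideLength_succ_pow_three)
open Summit.AtomisticToContinuum.BoseEinsteinCondensation.Theorems.CorrectorClosure.ResidueAreaLaw
  (stub_flatDomination stub_groundStateExists stub_flatJensen stub_fidelityLimit doubling_le_inv_residue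
    residueFloor_of_uniformLedger uniformLedger_of_residueFloor residueFloor_of_kac uniformLedger_of_kac
    uniformLedger_shortTime flatPartition_sq_le_mul flatPartition_sq_le_doubling flatPartition_cube_le
    stub_firstCorrectorBound stub_floorOfRelEntropy floorOfRelEntropy_swap fre_exp_neg_relEntropy_le_sq
    stub_occupationFloorFK_of_window stub_removalLaplace taggedZeroModeOccupation_le_lintegral
    taggedZeroModeOccupation_const_mul rl_toReal_eq_inner rl_pairing_tail_le)
open Summit.AtomisticToContinuum.BoseEinsteinCondensation.Theorems.CorrectorClosure.HealingScaleKacInsertion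
  (stub_nearMinimiserRigidity stub_uvTransfer stub_responseDictionary responseDictionary_sin
    hMinusOneSqW_tail_modes_le stub_firstCorrector)

set_option linter.unusedVariables false

/-! ## Conventions of the signatures

`Θ₀ : Config N → ℝ` with `IsPeriodicGroundStateFK v L Θ₀` is the bath ground state in Feynman–Kac form
(for the canonical term `periodicFKGroundState v N L` in the glue), `Φ₀ : Config (N+1) → ℝ` the
`(N+1)`-body one; particle `0` of `Config (N+1)` is the inserted / removed one (`vecCons x X`,
`vecTail`), as in `InsertionResidue`. The removal amplitude is `G X = ∫_{cell L} Φ₀ (vecCons x X) dx`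
(bound as `∀ G, G = … →` in the signatures, like `Z` in the ledger stubs). The insertion residue of the
pair is `A = ENNReal.ofReal (L⁻³ (∫_{cellN N L} Θ₀ X * G X)²)`. Division-free in `ℝ≥0∞` except inside
`ENNReal.ofReal`. -/

/-! ## Stubs (the open / delegated lemmas of the line; `sorry` only here) -/

/-- **Heart, factor 1 (v6) — torus BEC given K1, bounded potentials (size XL, OPEN, held by the
lead; K1 consumed HERE, by name).** Given `StaticResponseBound`, for every BOUNDED repulsive
finite-range `v`: the body of the summit-wide statement `PeriodicBEC` (item
stmt-AtomisticToContinuum-0826) VERBATIM — there is `ρ₀ > 0` such that for `0 < ρ < ρ₀` there is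
`c > 0` with, for all large `N`, some `δ > 0` such that every periodic `δ`-near-minimiser `Ψ` of the
`N`-body energy on the torus of side `(N/ρ)^{1/3}` has `⟨Ψ, n₀Ψ⟩ = condensateOccupation ≥ cN`.
NECESSARY for the crux: by `Negative.succ_mul_overlap_sq_le_condensateOccupation` (Disproof §5) and the
proved support `ResidueCondenses`, `CorrectorClosure ∧ StaticResponseBound` implies this for every
admissible `v`; and necessary for the v5 heart by `A ≤ f₀` at the level of the true ground states.
Why plausibly true: Bogoliubov `n₀/N = 1 − (8/(3√π))√(ρa³)`; Fournais 2020 Thm 1.2 / Junge 2026 Cor. 6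
prove it on length scales `L ≲ (ρa³)^{-δ}(ρa)^{-1/2}` resp. `≲ a(ρa³)^{-3/4-η}` (barrier
`KineticGapLengthScalesNarrow`); K1 adds the `N`-uniform first-order (one-phonon + recoil) bricks
(`stub_firstCorrectorBound`, `stub_responseDictionary`). Why it might fail to be PROVABLE from K1: K1 is
a DENSITY-sector statement (`N m₋₁(p) ≤ CN/max(ρa,p²)`), BEC is a one-body-sector statement; no
`static response ⇒ ODLRO` implication exists in print in `d = 3`, and in `d = 1` the K1-analogue
(momentum-uniform compressibility) is what EXCLUDES BEC (Pitaevskii–Stringari; Disproof §13). This is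
the promoted-item candidate `K1 → PeriodicBEC(v)`; any proof of item 0826's statement discharges it.
Size XL (open). Leans on: `StaticResponseBound` (hypothesis); nothing in the tree supplies it.
[cite: LSSY2005, Ch. 5 (5.1)–(5.2); Fournais2020, Thm 1.2] -/
theorem stub_periodicBEC (hK1 : StaticResponseBound) (v : ℝ → ℝ≥0∞) (hv : IsRepulsiveFiniteRange v)
    (hbdd : ∃ C : ℝ≥0, ∀ r, v r ≤ C) :
    ∃ ρ₀ : ℝ, 0 < ρ₀ ∧ ∀ ρ : ℝ, 0 < ρ → ρ < ρ₀ → ∃ c : ℝ, 0 < c ∧ ∀ᶠ N : ℕ in atTop,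
      ∃ δ : ℝ≥0∞, 0 < δ ∧ ∀ Ψ : PeriodicTrialState N (sideLength ρ N),
        periodicEnergy v Ψ ≤ periodicGroundStateEnergy v N (sideLength ρ N) + δ →
        ENNReal.ofReal (c * N) ≤ condensateOccupation N (sideLength ρ N) Ψ.ψ := by
  sorry

/-- **Heart, factor 2 (v6) — the removal (hole) residue floor given K1, bounded potentials (size XL,
OPEN, held by the lead; K1 consumed HERE, by name).** Given `StaticResponseBound`, for every BOUNDED
repulsive finite-range `v` there is `ρ₃ > 0` such that for `0 < ρ < ρ₃` there is `c₂ > 0` with, for all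
large `N` (box `L = sideLength ρ (N+1)`, `v^per` bounded there) and all continuous positive torus FK
ground states `Θ₀` (`N` bodies), `Φ₀` (`N+1` bodies): `c₂ ∫_{cell^N} G² ≤ (∫_{cell^N} Θ₀ G)²`,
`G(X) = ∫_cell Φ₀(x,X) dx` — the normalised zero-mode REMOVAL state `Ĝ = G/‖G‖` (`∝ a₀Φ₀`) keeps an
`N`-uniform overlap with the `N`-body ground state (hole residue `Z_hole ≥ c₂` at `k = 0`).
NECESSARY for the v5 heart (`F = A/f₀ ≥ A` since `f₀ ≤ 1`). What is settled: `Ĝ` is a LOW-ENERGY state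
of `H_N` in Laplace form, `∫Ĝe^{-tH_N}Ĝ ≥ f₀ e^{-t(E₀(N)+μ_N)}` (`stub_removalLaplace`,
`μ_N = E₀(N+1) − E₀(N) ≤ ρ_N∫v`, p90848) — with NO Born term, so this factor is typed identically for
hard cores once the hard-core FK frame exists. OPEN content: the ground-state component of a state whose
only credential is an `O(ρ)` (one healing-scale phonon's worth of) energy budget — the infrared problem of
the line (many soft two-phonon states below `μ_N`; first order `N`-uniform by K1 + recoil, beyond first
order = the route's `χ₂` difficulty). Why plausibly true: Bogoliubov `a₀Φ₀ ≈ √n₀ Θ₀`,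
`Z_hole = 1 − O(√(ρa³))`; GP/MF-scale theorems: Lampart–Triay 2025 Cor. 1.6, Myśliwy–Seiringer 2020.
Size XL (open). Leans on: `StaticResponseBound` (hypothesis), `stub_removalLaplace`,
`stub_firstCorrectorBound` (p117568), `IsPeriodicGroundStateFK`.
[cite: PenroseOnsager1956, §4; LampartTriay2025, Cor. 1.6] -/
theorem stub_removalFidelity (hK1 : StaticResponseBound) (v : ℝ → ℝ≥0∞) (hv : IsRepulsiveFiniteRange v)
    (hbdd : ∃ C : ℝ≥0, ∀ r, v r ≤ C) :
    ∃ ρ₃ : ℝ, 0 < ρ₃ ∧ ∀ ρ : ℝ, 0 < ρ → ρ < ρ₃ → ∃ c₂ : ℝ, 0 < c₂ ∧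
      ∀ᶠ N : ℕ in atTop, ∀ (L : ℝ), L = sideLength ρ (N + 1) →
        (∃ C : ℝ≥0, ∀ x, periodizedPotential v L x ≤ C) →
        ∀ (Θ₀ : Config N → ℝ), IsPeriodicGroundStateFK v L Θ₀ → Continuous Θ₀ → (∀ X, 0 < Θ₀ X) →
        ∀ (Φ₀ : Config (N + 1) → ℝ), IsPeriodicGroundStateFK v L Φ₀ → Continuous Φ₀ →
          (∀ X, 0 < Φ₀ X) →
        ∀ (G : Config N → ℝ), (G = fun X => ∫ x in cell L, Φ₀ (vecCons x X)) →
          ENNReal.ofReal c₂ * ∫⁻ X in cellN N L, ENNReal.ofReal (G X) ^ 2 ≤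
            ENNReal.ofReal ((∫ X in cellN N L, Θ₀ X * G X) ^ 2) := by
  sorry

/-- **Stub — the unbounded (hard / singular core) case: the crux itself for unbounded admissible
potentials; typed VERBATIM as `HealingScaleKacInsertion.stub_unboundedCase` (UNDELEGATED; the honest hole
of both FK lines).** For an admissible `v` that is NOT bounded (hard cores `v = ⊤` on a set of radii, or
finite but unbounded cores) the FK chain has no input: the tree's torus Feynman–Kac theory is stated and
proved for BOUNDED periodised potentials only (`PeriodicHeatFlowSpectral.lean`, "What is NOT here: hard
cores"). What a proof would need: EITHER (i) the hard-core FK frame — connectivity of the dilute free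
region `{|xᵢ−xⱼ|_𝕋 > R₀}` (`ρR₀³ ≪ 1`), positivity improving of the killed semigroup on it,
`E₀^per < ⊤` eventually (Ruelle, `exists_eventually_periodicGroundStateEnergy_lt_top`), small-time form
bounds for `C¹` states vanishing on the cores — and then the bounded-case chain verbatim IN ITS REMOVAL
FORM (v6: the removal state carries the pair dressing, no Born term); OR (ii) a truncation
`v_n = min(v, n) ↑ v` with the bounded-case constants `(ρ₀, c)` UNIFORM in `n` plus
`E₀^per(v_n) ↑ E₀^per(v)` at fixed `N, L`. Crux-sized by construction (it is `StaticResponseBound →` the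
body of `InsertionResidue` for unbounded `v`); registered so that the composition is honest and the hole
is attackable by name; `promote-stub` candidate. Diluteness (Disproof §10) respected: `∃ ρ₀ > 0`.
Size XL (open). [cite: LSSY2005, Thm 2.5 (E₀ < ⊤ via Dyson's lemma)] -/
theorem stub_unboundedCase (hK1 : StaticResponseBound) (v : ℝ → ℝ≥0∞) (hv : IsRepulsiveFiniteRange v)
    (hub : ¬ ∃ C : ℝ≥0, ∀ r, v r ≤ C) :
    ∃ ρ₀ : ℝ, 0 < ρ₀ ∧ ∀ ρ : ℝ, 0 < ρ → ρ < ρ₀ → ∃ c : ℝ, 0 < c ∧ ∀ᶠ N : ℕ in Filter.atTop,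
      ∃ δ : ENNReal, 0 < δ ∧ ∃ Θ : PeriodicTrialState N (sideLength ρ (N + 1)),
        periodicEnergy v Θ ≤ periodicGroundStateEnergy v N (sideLength ρ (N + 1)) + δ ∧
        ∀ Ψ : PeriodicTrialState (N + 1) (sideLength ρ (N + 1)),
          periodicEnergy v Ψ ≤ periodicGroundStateEnergy v (N + 1) (sideLength ρ (N + 1)) + δ →
          ENNReal.ofReal c ≤ ENNReal.ofReal ((sideLength ρ (N + 1) ^ 3)⁻¹) *
            (‖∫ X in cellN N (sideLength ρ (N + 1)), conj (Θ.ψ X) *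
                ∫ x in cell (sideLength ρ (N + 1)), Ψ.ψ (vecCons x X)‖₊ : ℝ≥0∞) ^ 2 := by
  sorry

/-! ## Sorry-free helpers of the composition -/

/-- The removal amplitude of a positive function is nonnegative. [folklore] -/
theorem removalAmplitude_nonneg {N : ℕ} (L : ℝ) {Φ₀ : Config (N + 1) → ℝ} (hΦp : ∀ X, 0 < Φ₀ X)
    (X : Config N) : 0 ≤ ∫ x in cell L, Φ₀ (vecCons x X) :=
  setIntegral_nonneg (measurableSet_cell L) fun x _ => (hΦp _).le

/-- **The zero-mode occupation of a real positive function, in removal-amplitude form**: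
`taggedZeroModeOccupation N L Φ₀ = (ofReal L ^ 3)⁻¹ ∫⁻_{cell^N} ofReal (G X)²`,
`G X = ∫_cell Φ₀(x, X) dx ≥ 0` (pointwise `‖∫ (Φ₀ : ℂ)‖₊² = ofReal G²`). [folklore] -/
theorem taggedZeroModeOccupation_ofReal {N : ℕ} (L : ℝ) {Φ₀ : Config (N + 1) → ℝ}
    (hΦp : ∀ X, 0 < Φ₀ X) :
    taggedZeroModeOccupation N L (fun X => (Φ₀ X : ℂ)) =
      (ENNReal.ofReal L ^ 3)⁻¹ *
        ∫⁻ X in cellN N L, ENNReal.ofReal (∫ x in cell L, Φ₀ (vecCons x X)) ^ 2 := by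
  unfold taggedZeroModeOccupation
  congr 1
  refine lintegral_congr fun X => ?_
  have hG : 0 ≤ ∫ x in cell L, Φ₀ (vecCons x X) := removalAmplitude_nonneg L hΦp X
  have h1 : (∫ x in cell L, ((Φ₀ (vecCons x X) : ℝ) : ℂ)) = ((∫ x in cell L, Φ₀ (vecCons x X) : ℝ) : ℂ) :=
    integral_ofReal
  have h2 : ((‖((∫ x in cell L, Φ₀ (vecCons x X) : ℝ) : ℂ)‖₊ : ℝ≥0∞)) =
      ENNReal.ofReal (∫ x in cell L, Φ₀ (vecCons x X)) := by
    rw [← enorm_eq_nnnorm, ← ofReal_norm, Complex.norm_real, Real.norm_of_nonneg hG]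
  rw [h1, h2]

/-- **The v5 heart from the v6 factors (kernel-checked glue; `sorry` only through the stubs).**
`f₀(Φ₀) ≥ c₁` (torus BEC at index `N+1`, `stub_periodicBEC` shifted by `tendsto_add_atTop_nat` and
transferred to the FK ground state by `stub_occupationFloorFK_of_window`) and `c₂∫G² ≤ (∫Θ₀G)²`
(`stub_removalFidelity`) give `A = L⁻³(∫Θ₀G)² ≥ L⁻³ c₂ ∫G² = c₂ f₀ ≥ c₁c₂`. [folklore] -/
theorem residueFloor_of_factors (hK1 : StaticResponseBound) (v : ℝ → ℝ≥0∞)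
    (hv : IsRepulsiveFiniteRange v) (hbdd : ∃ C : ℝ≥0, ∀ r, v r ≤ C) :
    ∃ ρ₂ : ℝ, 0 < ρ₂ ∧ ∀ ρ : ℝ, 0 < ρ → ρ < ρ₂ → ∃ c : ℝ, 0 < c ∧
      ∀ᶠ N : ℕ in atTop, ∀ (L : ℝ), L = sideLength ρ (N + 1) →
        (∃ C : ℝ≥0, ∀ x, periodizedPotential v L x ≤ C) →
        ∀ (Θ₀ : Config N → ℝ), IsPeriodicGroundStateFK v L Θ₀ → Continuous Θ₀ → (∀ X, 0 < Θ₀ X) →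
        ∀ (Φ₀ : Config (N + 1) → ℝ), IsPeriodicGroundStateFK v L Φ₀ → Continuous Φ₀ →
          (∀ X, 0 < Φ₀ X) →
          ENNReal.ofReal c ≤
            ENNReal.ofReal ((L ^ 3)⁻¹ *
              (∫ X in cellN N L, Θ₀ X * ∫ x in cell L, Φ₀ (vecCons x X)) ^ 2) := by
  obtain ⟨ρ₀, hρ₀, hBEC⟩ := stub_periodicBEC hK1 v hv hbdd
  obtain ⟨ρ₃, hρ₃, hFid⟩ := stub_removalFidelity hK1 v hv hbdd
  refine ⟨min ρ₀ ρ₃, lt_min hρ₀ hρ₃, fun ρ hρ hρlt => ?_⟩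
  have hρ₀' : ρ < ρ₀ := lt_of_lt_of_le hρlt (min_le_left _ _)
  have hρ₃' : ρ < ρ₃ := lt_of_lt_of_le hρlt (min_le_right _ _)
  obtain ⟨c₁, hc₁, hBECc⟩ := hBEC ρ hρ hρ₀'
  obtain ⟨c₂, hc₂, hFidc⟩ := hFid ρ hρ hρ₃'
  refine ⟨c₁ * c₂, by positivity, ?_⟩
  -- shift the BEC statement to index `N + 1`
  have hBEC' : ∀ᶠ N : ℕ in atTop, ∃ δ : ℝ≥0∞, 0 < δ ∧
      ∀ Ψ : PeriodicTrialState (N + 1) (sideLength ρ (N + 1)),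
        periodicEnergy v Ψ ≤ periodicGroundStateEnergy v (N + 1) (sideLength ρ (N + 1)) + δ →
        ENNReal.ofReal (c₁ * ((N : ℝ) + 1)) ≤ condensateOccupation (N + 1) (sideLength ρ (N + 1)) Ψ.ψ := by
    have h := (tendsto_add_atTop_nat 1).eventually hBECc
    filter_upwards [h] with N hN
    obtain ⟨δ, hδ, hΨ⟩ := hN
    refine ⟨δ, hδ, fun Ψ hΨE => ?_⟩
    have := hΨ Ψ hΨE
    simpa [Nat.cast_succ] using this
  filter_upwards [hBEC', hFidc] with N hBECN hFidN L hL_def hb Θ₀ hΘ hΘc hΘp Φ₀ hΦ hΦc hΦp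
  have hL : 0 < L := by rw [hL_def]; exact sideLength_succ_pos hρ N
  obtain ⟨δ, hδ, hwin⟩ := hBECN
  set G : Config N → ℝ := fun X => ∫ x in cell L, Φ₀ (vecCons x X) with hG_def
  -- factor 1: `c₁ ≤ f₀(Φ₀)`
  have hf₀ : ENNReal.ofReal c₁ ≤ taggedZeroModeOccupation N L (fun X => (Φ₀ X : ℂ)) := by
    subst hL_def
    exact stub_occupationFloorFK_of_window v hv.1 N _ hL hb Φ₀ hΦ hΦc hΦp c₁ hc₁.le δ hδ hwin
  rw [taggedZeroModeOccupation_ofReal L hΦp] at hf₀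
  -- factor 2: `c₂ ∫ G² ≤ (∫ Θ₀ G)²`
  have hF : ENNReal.ofReal c₂ * ∫⁻ X in cellN N L, ENNReal.ofReal (G X) ^ 2 ≤
      ENNReal.ofReal ((∫ X in cellN N L, Θ₀ X * G X) ^ 2) :=
    hFidN L hL_def hb Θ₀ hΘ hΘc hΘp Φ₀ hΦ hΦc hΦp G rfl
  -- combine: `c₁ c₂ ≤ c₂ · (L³)⁻¹ ∫G² ≤ (L³)⁻¹ (∫Θ₀G)²`
  have hL3 : ENNReal.ofReal L ^ 3 ≠ 0 := pow_ne_zero _ (ENNReal.ofReal_pos.2 hL).ne'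
  have hL3' : ENNReal.ofReal L ^ 3 ≠ ⊤ := ENNReal.pow_ne_top ENNReal.ofReal_ne_top
  calc ENNReal.ofReal (c₁ * c₂)
      = ENNReal.ofReal c₂ * ENNReal.ofReal c₁ := by
        rw [ENNReal.ofReal_mul hc₁.le, mul_comm]
    _ ≤ ENNReal.ofReal c₂ * ((ENNReal.ofReal L ^ 3)⁻¹ *
          ∫⁻ X in cellN N L, ENNReal.ofReal (G X) ^ 2) := by gcongr
    _ = (ENNReal.ofReal L ^ 3)⁻¹ *
          (ENNReal.ofReal c₂ * ∫⁻ X in cellN N L, ENNReal.ofReal (G X) ^ 2) := by ring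
    _ ≤ (ENNReal.ofReal L ^ 3)⁻¹ * ENNReal.ofReal ((∫ X in cellN N L, Θ₀ X * G X) ^ 2) := by
        gcongr
    _ = ENNReal.ofReal ((L ^ 3)⁻¹ * (∫ X in cellN N L, Θ₀ X * G X) ^ 2) := by
        rw [ENNReal.ofReal_mul (by positivity), ENNReal.ofReal_inv_of_pos (by positivity),
          ENNReal.ofReal_pow hL.le]

/-! ## Composition (sorry-free): the registered stubs give the crux BY NAME -/

/-- **`CorrectorClosure` from the registered stubs** (kernel-checked glue, no `sorry` of its own).
Unbounded `v`: `stub_unboundedCase`. Bounded `v`: thresholds `min ρᵢ`; eventually in `N`: FK ground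
states `Θ₀`, `Φ₀` from `stub_groundStateExists`; K1 ⇒ the floor `c ≤ A` (`residueFloor_of_factors`:
torus BEC × removal fidelity); rigidity (`stub_nearMinimiserRigidity` at `ε = c/2`) transfers this to
`Res(Θ, Ψ) ≥ c/2` for all `δ`-near-minimisers `Ψ`, some `δ`-near-minimiser `Θ`. [folklore] -/
theorem CorrectorClosure_of : CorrectorClosure := by
  intro hK1 v hv
  by_cases hbdd : ∃ C : ℝ≥0, ∀ r, v r ≤ C
  swap
  · exact stub_unboundedCase hK1 v hv hbdd
  obtain ⟨ρA, hρA, hGS⟩ := stub_groundStateExists v hv hbdd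
  obtain ⟨ρ₂, hρ₂, hFl⟩ := residueFloor_of_factors hK1 v hv hbdd
  refine ⟨min ρA ρ₂, lt_min hρA hρ₂, fun ρ hρ hρlt => ?_⟩
  have hρA' : ρ < ρA := lt_of_lt_of_le hρlt (min_le_left _ _)
  have hρ₂' : ρ < ρ₂ := lt_of_lt_of_le hρlt (min_le_right _ _)
  obtain ⟨c, hc, hFlc⟩ := hFl ρ hρ hρ₂'
  refine ⟨c / 2, by positivity, ?_⟩
  filter_upwards [hGS ρ hρ hρA', hFlc] with N hGSN hFlN
  obtain ⟨hb, ⟨hΘ, hΘc, hΘp⟩, ⟨hΦ, hΦc, hΦp⟩⟩ := hGSN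
  set L : ℝ := sideLength ρ (N + 1) with hL_def
  have hL : 0 < L := sideLength_succ_pos hρ N
  set Θ₀ : Config N → ℝ := periodicFKGroundState v N L with hΘ₀_def
  set Φ₀ : Config (N + 1) → ℝ := periodicFKGroundState v (N + 1) L with hΦ₀_def
  set A : ℝ≥0∞ := ENNReal.ofReal ((L ^ 3)⁻¹ *
      (∫ X in cellN N L, Θ₀ X * ∫ x in cell L, Φ₀ (vecCons x X)) ^ 2) with hA_def
  -- the heart: `c ≤ A`
  have hfloor : ENNReal.ofReal c ≤ A := hFlN L rfl hb Θ₀ hΘ hΘc hΘp Φ₀ hΦ hΦc hΦp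
  -- rigidity at `ε = c/2`: transfer to the near-minimiser frame
  obtain ⟨δ, hδ, Θ, hΘE, hΨ⟩ := stub_nearMinimiserRigidity v hv N L hL hb Θ₀ hΘ hΘc hΘp Φ₀ hΦ hΦc hΦp
    (c / 2) (by positivity)
  refine ⟨δ, hδ, Θ, hΘE, fun Ψ hΨE => ?_⟩
  set R : ℝ≥0∞ := ENNReal.ofReal ((L ^ 3)⁻¹) *
      (‖∫ X in cellN N L, conj (Θ.ψ X) * ∫ x in cell L, Ψ.ψ (vecCons x X)‖₊ : ℝ≥0∞) ^ 2 with hR_def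
  have hAR : A ≤ R + ENNReal.ofReal (c / 2) := hΨ Ψ hΨE
  have hsplit : ENNReal.ofReal c = ENNReal.ofReal (c / 2) + ENNReal.ofReal (c / 2) := by
    rw [← ENNReal.ofReal_add (by positivity) (by positivity)]
    congr 1; ring
  have h2 : ENNReal.ofReal (c / 2) + ENNReal.ofReal (c / 2) ≤ R + ENNReal.ofReal (c / 2) := by
    rw [← hsplit]; exact hfloor.trans hAR
  exact (ENNReal.add_le_add_iff_right ENNReal.ofReal_ne_top).1 h2

end Summit.AtomisticToContinuum.BoseEinsteinCondensation.Cruxes.CorrectorClosure.ResidueAreaLaw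

end
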